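import Literature.NumberTheory.Weil1964.AdelicThetaMajorants
import Literature.NumberTheory.Automorphic.FiniteAdeleFactorizable
import Literature.Analysis.Distribution.SchwartzEnvelope
import HarnessLib

/-!
# Dominated families I: the twists `Φ(x g)`, `g` in a compact subset of `GL_n(𝔸_F)`, are majorised by ONE
# Schwartz–Bruhat function

Topic `NumberTheory/Weil1964`; namespace `Literature.NumberTheory.Weil1964`.  KERNEL mathematics only (theorems; no
definition, no named fact, no `axiom`, no proof hole).

Weil's boundedness argument in the proof of the Siegel formula ([Weil1965] Chap. V n° 50, Lemmas 21–23 and (39)–(40))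
evaluates POSITIVE tempered measures on `X_𝔸` at the functions `|ω(S) Φ|` for `S` ranging over a COMPACT set of the
(metaplectic) group and needs one Schwartz–Bruhat function majorising them all; for the operators that act
geometrically — the twists `d(g) : Φ ↦ Φ(· g)` of ★ `Weil1964/AdelicThetaDistribution` (`twist F g Φ`) — this is
[Weil1964, Chap. III n° 41, Lemme 5 p. 194] «il existe `Φ₀ ∈ 𝒮(X_A)` telle que l'on ait `|SΦ(x)| ≤ Φ₀(x)` quels que
soient `x ∈ X_A` et `S ∈` (un compact)».  The tree has the RATIONAL-POINT form of Lemme 5 (★ `AdelicThetaMajorants.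
exists_summable_majorant_twist_of_isCompact`: a summable majorant over `ξ ∈ Fⁿ`); this file proves the POINTWISE ADELIC
form:

* `exists_piSchwartzBruhat_dominating_twists` — **for `Φ ∈ 𝒮(𝔸_Fⁿ)` and a compact `C ⊆ GL_n(𝔸_F)` there is
  `Φ₀ ∈ 𝒮(𝔸_Fⁿ)`, real and non-negative (`(Φ₀ x).im = 0`, `0 ≤ (Φ₀ x).re`), with `‖Φ(x g)‖ ≤ (Φ₀ x).re` for every
  `g ∈ C` and EVERY `x ∈ 𝔸_Fⁿ`.**

Proof.  Domination is additive and homogeneous, so by the span structure of `𝒮(𝔸_Fⁿ)` (★ `piSchwartzBruhat` = span of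
the factorizable `Φ_∞ ⊗ Φ_f`) it suffices to treat `Φ = Φ_∞ ⊗ Φ_f`; then `Φ(x g) = Φ_∞(x_∞ g_∞) Φ_f(x_f g_f)`
(★ `vecInfinitePart_vecMul`, `vecFinitePart_vecMul_eq_sndHom`).  ARCHIMEDEAN factor (§1, §3): `‖x_∞‖ ≤ G(g) ‖x_∞ g_∞‖`
with `G(g) = Σ_{k,l} ‖(g⁻¹)_{∞,kl}‖ ≤ n² H_∞(g)` bounded on `C` (★ `sum_norm_inv_arch_le_mul_archHeight`,
★ `GLn.continuous_archHeight`), so the Schwartz decay of `Φ_∞` gives `‖Φ_∞(x_∞ g_∞)‖ (1 + ‖x_∞‖)^N ≤ G₀^N · 2^N p_N(Φ_∞)`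
UNIFORMLY on `C`, and the Schwartz envelope of ★ `Analysis/Distribution/SchwartzEnvelope` produces a Schwartz majorant
`E ≥ sup_{g ∈ C} |Φ_∞(· g_∞)|`.  FINITE factor (§2): the finite parts `x_f` with `x_f g_f ∈ supp Φ_f` for some `g ∈ C`
form the set `D = supp Φ_f · C_f⁻¹`, which is compact (continuous image of `supp Φ_f × C_f`) and open (a union of
preimages of the open set `supp Φ_f`), so `B · 𝟙_D` (`B = sup |Φ_f|`) is a Schwartz–Bruhat majorant
(★ `indicator_one_mem_schwartzBruhat`); `Φ₀ := E ⊗ B 𝟙_D`.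

Cell hodgecm-mathlib, FLOOR 0, engine E-2 (crux item H413, `--supports stmt-HodgeConjecture-24833`), row G3 «dominated
families» (the `{d(c)Ψ : c ∈ C_E}` half consumed by ray (B) of the SW2c-BOUND census).  HC_CM is proved only modulo the
printed citations until rung 0 closes; nothing in this file is about Hodge classes.

## References
* [Weil1964] A. Weil, *Sur certains groupes d'opérateurs unitaires*, Acta Math. 111 (1964) 143–211, Chap. III n° 41,
  Lemme 5 p. 194.
* [Weil1965] A. Weil, *Sur la formule de Siegel dans la théorie des groupes classiques*, Acta Math. 113 (1965) 1–87,
  Chap. V n° 50.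
* [GodementJacquetLNM260] R. Godement, H. Jacquet, *Zeta functions of simple algebras*, LNM 260 (1972), §11 (Lemma 11.5).
-/

set_option autoImplicit false

noncomputable section

open scoped BigOperators NNReal Matrix Topology Classical RestrictedProduct
open NumberField NumberField.mixedEmbedding IsDedekindDomain Set Filter

namespace Literature.NumberTheory.Weil1964

open Literature.NumberTheory.Automorphic Literature.Analysis.Distribution

variable (F : Type) [Field F] [NumberField F] {n : ℕ}

/-! ## §1 The archimedean size of `g⁻¹` controls `‖x_∞‖` by `‖(x g)_∞‖`, for EVERY adelic `x` -/

section Arch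

/-- `‖x_∞‖ ≤ G(g) ‖(x g)_∞‖` with `G(g) = Σ_{k,l} ‖(g⁻¹)_{∞,kl}‖`, for every `x ∈ 𝔸_Fⁿ` (write `x = (x g) g⁻¹` and use
`(y A)_∞ = y_∞ A_∞`).  The rational-vector case is ★ `norm_vecInfinitePart_ratVec_le_mul`.
[cite: Weil1964, Chap. III n° 41, Lemme 5 p. 194] -/
theorem norm_vecInfinitePart_le_mul_norm_vecInfinitePart_vecMul (x : Fin n → AdeleRing (𝓞 F) F)
    (g : GL (Fin n) (AdeleRing (𝓞 F) F)) :
    ‖vecInfinitePart F n x‖ ≤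
      (∑ k, ∑ l, ‖(((g⁻¹ : GL (Fin n) (AdeleRing (𝓞 F) F)) :
          Matrix (Fin n) (Fin n) (AdeleRing (𝓞 F) F)).map
            fun a => InfiniteAdeleRing.ringEquiv_mixedSpace F a.1) k l‖) *
        ‖vecInfinitePart F n (x ᵥ* (g : Matrix (Fin n) (Fin n) (AdeleRing (𝓞 F) F)))‖ := by
  have hx : x = x ᵥ* (g : Matrix (Fin n) (Fin n) (AdeleRing (𝓞 F) F)) ᵥ*
      ((g⁻¹ : GL (Fin n) (AdeleRing (𝓞 F) F)) : Matrix (Fin n) (Fin n) (AdeleRing (𝓞 F) F)) := by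
    rw [Matrix.vecMul_vecMul, ← Matrix.GeneralLinearGroup.coe_mul, mul_inv_cancel,
      Matrix.GeneralLinearGroup.coe_one, Matrix.vecMul_one]
  have h := congrArg (vecInfinitePart F n) hx
  rw [vecInfinitePart_vecMul] at h
  conv_lhs => rw [h]
  exact norm_vecMul_le _ _

/-- On a compact `C ⊆ GL_n(𝔸_F)` the sizes `G(g) = Σ_{k,l} ‖(g⁻¹)_{∞,kl}‖` are bounded by some `G₀ ≥ 1`
(`G(g) ≤ n² H_∞(g)`, ★ `sum_norm_inv_arch_le_mul_archHeight`, and the archimedean height is continuous).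
[cite: Weil1964, Chap. III n° 41, Lemme 5 p. 194] -/
theorem exists_bound_sum_norm_inv_arch_of_isCompact {C : Set (GL (Fin n) (AdeleRing (𝓞 F) F))}
    (hC : IsCompact C) :
    ∃ G₀ : ℝ, 1 ≤ G₀ ∧ ∀ g ∈ C,
      (∑ k, ∑ l, ‖(((g⁻¹ : GL (Fin n) (AdeleRing (𝓞 F) F)) :
          Matrix (Fin n) (Fin n) (AdeleRing (𝓞 F) F)).map
            fun a => InfiniteAdeleRing.ringEquiv_mixedSpace F a.1) k l‖) ≤ G₀ := by
  have hHc : Continuous fun g : GL (Fin n) (AdeleRing (𝓞 F) F) =>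
      (n : ℝ) ^ 2 * (GLn.archHeight n F g : ℝ) :=
    continuous_const.mul (NNReal.continuous_coe.comp (GLn.continuous_archHeight (n := n) (K := F)))
  obtain ⟨G₁, hG₁⟩ := hC.exists_bound_of_continuousOn hHc.continuousOn
  refine ⟨max 1 G₁, le_max_left _ _, fun g hg => ?_⟩
  refine (sum_norm_inv_arch_le_mul_archHeight F g).trans ?_
  exact ((Real.le_norm_self _).trans (hG₁ g hg)).trans (le_max_right _ _)

end Arch

/-! ## §2 The finite parts that can reach an open compact set through `C` form an open compact set -/

section Finite

/-- For an OPEN COMPACT `S_f ⊆ (𝔸_F^∞)ⁿ` (the support of a Bruhat function) and a compact `𝒴 ⊆ GL_n(𝔸_F^∞)`, the set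
of finite parts `x_f` with `x_f L_f ∈ S_f` for some `L_f ∈ 𝒴` is contained in an open compact `D` — indeed one may take
`D = S_f · 𝒴⁻¹` itself: compact as the continuous image of `S_f × 𝒴`, open as the union over `L_f ∈ 𝒴` of the preimages
of `S_f` under `x_f ↦ x_f L_f`.  (Rational-vector, compact-only form: ★ `exists_isCompact_vecFinitePart_mem`.)
[cite: Weil1964, Chap. III n° 41, Lemme 5 p. 194] -/
theorem exists_isCompact_isOpen_vecFinitePart_mem {Sf : Set (Fin n → FiniteAdeleRing (𝓞 F) F)}
    (hSc : IsCompact Sf) (hSo : IsOpen Sf) {𝒴 : Set (GL (Fin n) (FiniteAdeleRing (𝓞 F) F))} (h𝒴 : IsCompact 𝒴) :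
    ∃ D : Set (Fin n → FiniteAdeleRing (𝓞 F) F), IsCompact D ∧ IsOpen D ∧
      ∀ L : GL (Fin n) (AdeleRing (𝓞 F) F), GLn.sndHom n F L ∈ 𝒴 → ∀ x : Fin n → AdeleRing (𝓞 F) F,
        vecFinitePart F n (x ᵥ* (L : Matrix (Fin n) (Fin n) (AdeleRing (𝓞 F) F))) ∈ Sf →
          vecFinitePart F n x ∈ D := by
  set Φ : (Fin n → FiniteAdeleRing (𝓞 F) F) × GL (Fin n) (FiniteAdeleRing (𝓞 F) F) →
      (Fin n → FiniteAdeleRing (𝓞 F) F) := fun p =>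
    p.1 ᵥ* ((p.2⁻¹ : GL (Fin n) (FiniteAdeleRing (𝓞 F) F)) : Matrix (Fin n) (Fin n) (FiniteAdeleRing (𝓞 F) F))
    with hΦ
  have hΦc : Continuous Φ :=
    continuous_fst.matrix_vecMul (Units.continuous_val.comp (continuous_inv.comp continuous_snd))
  -- `D = S_f 𝒴⁻¹` is also the union of the preimages of `S_f` under right multiplication by `L_f ∈ 𝒴`
  have hD : Φ '' (Sf ×ˢ 𝒴) = ⋃ L ∈ 𝒴, (fun y : Fin n → FiniteAdeleRing (𝓞 F) F =>
      y ᵥ* ((L : GL (Fin n) (FiniteAdeleRing (𝓞 F) F)) : Matrix (Fin n) (Fin n) (FiniteAdeleRing (𝓞 F) F))) ⁻¹' Sf := by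
    ext z
    simp only [Set.mem_image, Set.mem_prod, Set.mem_iUnion, Set.mem_preimage, Prod.exists, hΦ]
    constructor
    · rintro ⟨y, L, ⟨hy, hL⟩, rfl⟩
      refine ⟨L, hL, ?_⟩
      rwa [Matrix.vecMul_vecMul, ← Matrix.GeneralLinearGroup.coe_mul, inv_mul_cancel,
        Matrix.GeneralLinearGroup.coe_one, Matrix.vecMul_one]
    · rintro ⟨L, hL, hz⟩
      refine ⟨_, L, ⟨hz, hL⟩, ?_⟩
      rw [Matrix.vecMul_vecMul, ← Matrix.GeneralLinearGroup.coe_mul, mul_inv_cancel,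
        Matrix.GeneralLinearGroup.coe_one, Matrix.vecMul_one]
  refine ⟨Φ '' (Sf ×ˢ 𝒴), (hSc.prod h𝒴).image hΦc, ?_, fun L hL x hx => ?_⟩
  · rw [hD]
    refine isOpen_biUnion fun L _ => hSo.preimage ?_
    exact continuous_id.matrix_vecMul continuous_const
  · refine ⟨(vecFinitePart F n (x ᵥ* (L : Matrix (Fin n) (Fin n) (AdeleRing (𝓞 F) F))), GLn.sndHom n F L),
      ⟨hx, hL⟩, ?_⟩
    simp only [hΦ]
    rw [vecFinitePart_vecMul_eq_sndHom, Matrix.vecMul_vecMul, ← Matrix.GeneralLinearGroup.coe_mul,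
      mul_inv_cancel, Matrix.GeneralLinearGroup.coe_one, Matrix.vecMul_one]

end Finite

/-! ## §3 The factorizable case -/

section Factorizable

/-- the archimedean matrix `g_∞` of `g ∈ GL_n(𝔸_F)` times that of `g⁻¹` is `1`. [folklore] -/
private theorem arch_mul_arch_inv (g : GL (Fin n) (AdeleRing (𝓞 F) F)) :
    ((g : GL (Fin n) (AdeleRing (𝓞 F) F)) : Matrix (Fin n) (Fin n) (AdeleRing (𝓞 F) F)).map
        (fun a => InfiniteAdeleRing.ringEquiv_mixedSpace F a.1) *
      (((g⁻¹ : GL (Fin n) (AdeleRing (𝓞 F) F)) : Matrix (Fin n) (Fin n) (AdeleRing (𝓞 F) F)).map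
        fun a => InfiniteAdeleRing.ringEquiv_mixedSpace F a.1) = 1 := by
  set f : AdeleRing (𝓞 F) F →+* mixedSpace F :=
    (InfiniteAdeleRing.ringEquiv_mixedSpace F).toRingHom.comp
      (RingHom.fst (InfiniteAdeleRing F) (FiniteAdeleRing (𝓞 F) F)) with hf
  have hfa : (fun a : AdeleRing (𝓞 F) F => InfiniteAdeleRing.ringEquiv_mixedSpace F a.1) = f := rfl
  rw [hfa, ← Matrix.map_mul, ← Matrix.GeneralLinearGroup.coe_mul, mul_inv_cancel, Matrix.GeneralLinearGroup.coe_one,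
    Matrix.map_one f (map_zero f) (map_one f)]

/-- `‖y‖ ≤ G(g) ‖y g_∞‖` for every `y ∈ (F ⊗ ℝ)ⁿ`. [folklore] -/
private theorem norm_le_mul_norm_vecMul_arch (y : Fin n → mixedSpace F) (g : GL (Fin n) (AdeleRing (𝓞 F) F)) :
    ‖y‖ ≤ (∑ k, ∑ l, ‖(((g⁻¹ : GL (Fin n) (AdeleRing (𝓞 F) F)) :
          Matrix (Fin n) (Fin n) (AdeleRing (𝓞 F) F)).map
            fun a => InfiniteAdeleRing.ringEquiv_mixedSpace F a.1) k l‖) *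
        ‖y ᵥ* ((g : GL (Fin n) (AdeleRing (𝓞 F) F)) : Matrix (Fin n) (Fin n) (AdeleRing (𝓞 F) F)).map
          (fun a => InfiniteAdeleRing.ringEquiv_mixedSpace F a.1)‖ := by
  set M₁ : Matrix (Fin n) (Fin n) (mixedSpace F) :=
    ((g : GL (Fin n) (AdeleRing (𝓞 F) F)) : Matrix (Fin n) (Fin n) (AdeleRing (𝓞 F) F)).map
      (fun a => InfiniteAdeleRing.ringEquiv_mixedSpace F a.1) with hM₁
  set M₂ : Matrix (Fin n) (Fin n) (mixedSpace F) :=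
    (((g⁻¹ : GL (Fin n) (AdeleRing (𝓞 F) F)) : Matrix (Fin n) (Fin n) (AdeleRing (𝓞 F) F))).map
      (fun a => InfiniteAdeleRing.ringEquiv_mixedSpace F a.1) with hM₂
  have hy : y = (y ᵥ* M₁) ᵥ* M₂ := by
    rw [Matrix.vecMul_vecMul, hM₁, hM₂, arch_mul_arch_inv, Matrix.vecMul_one]
  conv_lhs => rw [hy]
  exact norm_vecMul_le _ _

/-- **The factorizable case**: `Φ_∞ ⊗ Φ_f` admits a real non-negative Schwartz–Bruhat majorant of all its twists by
`g ∈ C`, `C` compact. [cite: Weil1964, Chap. III n° 41, Lemme 5 p. 194] -/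
theorem exists_piSchwartzBruhat_dominating_twists_of_isFactorizable {Ψ : (Fin n → AdeleRing (𝓞 F) F) → ℂ}
    (hΨ : IsFactorizablePiSchwartzBruhat F (Fin n) Ψ) {C : Set (GL (Fin n) (AdeleRing (𝓞 F) F))}
    (hC : IsCompact C) :
    ∃ Φ₀ : (Fin n → AdeleRing (𝓞 F) F) → ℂ, Φ₀ ∈ piSchwartzBruhat F (Fin n) ∧
      (∀ x, (Φ₀ x).im = 0 ∧ 0 ≤ (Φ₀ x).re) ∧ ∀ g ∈ C, ∀ x, ‖twist F g Ψ x‖ ≤ (Φ₀ x).re := by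
  obtain ⟨Ψinf, Ψfin, hfin, rfl⟩ := hΨ
  obtain ⟨hlc, hcs⟩ := (mem_schwartzBruhat_iff).1 hfin
  -- ARCHIMEDEAN: uniform rapid decay of `y ↦ Ψ_∞ (y g_∞)` on `C`, then the Schwartz envelope
  obtain ⟨G₀, hG₀1, hG₀⟩ := exists_bound_sum_norm_inv_arch_of_isCompact F hC
  have hG₀0 : 0 < G₀ := one_pos.trans_le hG₀1
  let A : GL (Fin n) (AdeleRing (𝓞 F) F) → Matrix (Fin n) (Fin n) (mixedSpace F) := fun g =>
    ((g : GL (Fin n) (AdeleRing (𝓞 F) F)) : Matrix (Fin n) (Fin n) (AdeleRing (𝓞 F) F)).map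
      (fun a => InfiniteAdeleRing.ringEquiv_mixedSpace F a.1)
  have hdecay : ∀ N : ℕ, ∃ c : ℝ, ∀ g ∈ C, ∀ y : Fin n → mixedSpace F,
      ‖Ψinf (y ᵥ* A g)‖ * (1 + ‖y‖) ^ N ≤ c := by
    intro N
    refine ⟨2 ^ N * (Finset.Iic (N, 0)).sup (fun m => SchwartzMap.seminorm ℝ m.1 m.2) Ψinf * G₀ ^ N,
      fun g hg y => ?_⟩
    have h1 : ‖y‖ ≤ G₀ * ‖y ᵥ* A g‖ :=
      (norm_le_mul_norm_vecMul_arch F y g).trans (mul_le_mul_of_nonneg_right (hG₀ g hg) (norm_nonneg _))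
    have h2 : 1 + ‖y‖ ≤ G₀ * (1 + ‖y ᵥ* A g‖) := by nlinarith [norm_nonneg (y ᵥ* A g)]
    have h3 : (1 + ‖y‖) ^ N ≤ G₀ ^ N * (1 + ‖y ᵥ* A g‖) ^ N := by
      rw [← mul_pow]; exact pow_le_pow_left₀ (by positivity) h2 N
    have h4 := SchwartzMap.one_add_le_sup_seminorm_apply (𝕜 := ℝ) (m := (N, 0)) (k := N) (n := 0) le_rfl le_rfl
      Ψinf (y ᵥ* A g)
    rw [norm_iteratedFDeriv_zero] at h4
    calc ‖Ψinf (y ᵥ* A g)‖ * (1 + ‖y‖) ^ N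
        ≤ ‖Ψinf (y ᵥ* A g)‖ * (G₀ ^ N * (1 + ‖y ᵥ* A g‖) ^ N) :=
          mul_le_mul_of_nonneg_left h3 (norm_nonneg _)
      _ = ((1 + ‖y ᵥ* A g‖) ^ N * ‖Ψinf (y ᵥ* A g)‖) * G₀ ^ N := by ring
      _ ≤ (2 ^ N * (Finset.Iic (N, 0)).sup (fun m => SchwartzMap.seminorm ℝ m.1 m.2) Ψinf) * G₀ ^ N :=
          mul_le_mul_of_nonneg_right h4 (by positivity)
  obtain ⟨E, hE0, hE⟩ := exists_schwartz_complex_forall_norm_le_of_uniform_rapid_decay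
    (S := C) (F := fun g y => Ψinf (y ᵥ* A g)) hdecay
  -- FINITE: the support of `Ψ_f` is open compact; the reachable finite parts form an open compact `D`
  have hSo : IsOpen (Function.support Ψfin) := hlc {0}ᶜ
  have hSc : IsCompact (Function.support Ψfin) := by
    refine hcs.of_isClosed_subset ?_ (subset_tsupport Ψfin)
    rw [← isOpen_compl_iff, Function.compl_support]
    exact hlc {0}
  obtain ⟨D, hDc, hDo, hD⟩ := exists_isCompact_isOpen_vecFinitePart_mem F hSc hSo (hC.image (GLn.continuous_sndHom))
  obtain ⟨B, hB⟩ := hcs.exists_bound_of_continuous hlc.continuous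
  have hB0 : 0 ≤ B := (norm_nonneg _).trans (hB 0)
  haveI : T2Space (FiniteAdeleRing (𝓞 F) F) := inferInstanceAs <| T2Space
    (Πʳ w : HeightOneSpectrum (𝓞 F), [w.adicCompletion F, w.adicCompletionIntegers F])
  have hDcl : IsClopen D := ⟨hDc.isClosed, hDo⟩
  have hind : D.indicator (fun _ => (1 : ℂ)) ∈ SchwartzBruhat (Fin n → FiniteAdeleRing (𝓞 F) F) :=
    indicator_one_mem_schwartzBruhat hDcl hDc
  have hfin' : ((B : ℂ) • D.indicator (fun _ => (1 : ℂ))) ∈ SchwartzBruhat (Fin n → FiniteAdeleRing (𝓞 F) F) :=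
    Submodule.smul_mem _ (B : ℂ) hind
  have hsm : ∀ y, ((B : ℂ) • D.indicator (fun _ => (1 : ℂ))) y = (B : ℂ) * D.indicator (fun _ => (1 : ℂ)) y :=
    fun _ => rfl
  -- the majorant `E ⊗ B 𝟙_D`
  refine ⟨fun x => E (piArch F (Fin n) x) * ((B : ℂ) • D.indicator (fun _ => (1 : ℂ))) (piFinite F (Fin n) x),
    tensor_mem_piSchwartzBruhat E hfin', fun x => ?_, fun g hg x => ?_⟩
  · change (E (piArch F (Fin n) x) * ((B : ℂ) • D.indicator (fun _ => (1 : ℂ))) (piFinite F (Fin n) x)).im = 0 ∧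
      0 ≤ (E (piArch F (Fin n) x) * ((B : ℂ) • D.indicator (fun _ => (1 : ℂ))) (piFinite F (Fin n) x)).re
    rw [hsm]
    obtain ⟨him, hre⟩ := hE0 (piArch F (Fin n) x)
    by_cases hx : piFinite F (Fin n) x ∈ D
    · rw [Set.indicator_of_mem hx, mul_one]
      refine ⟨by simp [Complex.mul_im, him], ?_⟩
      simp only [Complex.mul_re, Complex.ofReal_re, Complex.ofReal_im, mul_zero, sub_zero]
      exact mul_nonneg hre hB0
    · rw [Set.indicator_of_notMem hx, mul_zero, mul_zero]
      simp
  · change ‖Ψinf (vecInfinitePart F n (x ᵥ* (g : Matrix (Fin n) (Fin n) (AdeleRing (𝓞 F) F)))) *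
        Ψfin (vecFinitePart F n (x ᵥ* (g : Matrix (Fin n) (Fin n) (AdeleRing (𝓞 F) F))))‖ ≤
      (E (vecInfinitePart F n x) * ((B : ℂ) • D.indicator (fun _ => (1 : ℂ))) (vecFinitePart F n x)).re
    rw [hsm, vecInfinitePart_vecMul, norm_mul]
    by_cases hs : vecFinitePart F n (x ᵥ* (g : Matrix (Fin n) (Fin n) (AdeleRing (𝓞 F) F))) ∈ Function.support Ψfin
    · have hxD : vecFinitePart F n x ∈ D := hD g ⟨g, hg, rfl⟩ x hs
      rw [Set.indicator_of_mem hxD, mul_one]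
      obtain ⟨him, hre⟩ := hE0 (vecInfinitePart F n x)
      have hre' : ((E (vecInfinitePart F n x)) * (B : ℂ)).re = (E (vecInfinitePart F n x)).re * B := by
        simp [Complex.mul_re, him]
      rw [hre']
      exact mul_le_mul (hE g hg (vecInfinitePart F n x)) (hB _) (norm_nonneg _) hre
    · rw [Function.mem_support, not_not] at hs
      rw [hs, norm_zero, mul_zero]
      obtain ⟨him, hre⟩ := hE0 (vecInfinitePart F n x)
      by_cases hxD : vecFinitePart F n x ∈ D
      · rw [Set.indicator_of_mem hxD, mul_one]
        have hre' : ((E (vecInfinitePart F n x)) * (B : ℂ)).re = (E (vecInfinitePart F n x)).re * B := by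
          simp [Complex.mul_re, him]
        rw [hre']
        exact mul_nonneg hre hB0
      · rw [Set.indicator_of_notMem hxD, mul_zero, mul_zero]
        simp

end Factorizable

/-! ## §4 The general case: domination is additive -/

section Main

/-- **A compact family of twists of a Schwartz–Bruhat function is dominated by ONE Schwartz–Bruhat function**
([Weil1964, Chap. III n° 41, Lemme 5 p. 194], pointwise adelic form; [Weil1965, Chap. V n° 50], the family `{d(c)Ψ}` of the
boundedness lemmas): for `Ψ ∈ 𝒮(𝔸_Fⁿ)` and a compact `C ⊆ GL_n(𝔸_F)` there is `Φ₀ ∈ 𝒮(𝔸_Fⁿ)` with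
`(Φ₀ x).im = 0`, `0 ≤ (Φ₀ x).re` and `‖Ψ(x g)‖ ≤ (Φ₀ x).re` for all `g ∈ C`, `x ∈ 𝔸_Fⁿ`.
[cite: Weil1964, Chap. III n° 41, Lemme 5 p. 194] [cite: Weil1965, Chap. V n° 50] -/
theorem exists_piSchwartzBruhat_dominating_twists {Ψ : (Fin n → AdeleRing (𝓞 F) F) → ℂ}
    (hΨ : Ψ ∈ piSchwartzBruhat F (Fin n)) {C : Set (GL (Fin n) (AdeleRing (𝓞 F) F))} (hC : IsCompact C) :
    ∃ Φ₀ : (Fin n → AdeleRing (𝓞 F) F) → ℂ, Φ₀ ∈ piSchwartzBruhat F (Fin n) ∧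
      (∀ x, (Φ₀ x).im = 0 ∧ 0 ≤ (Φ₀ x).re) ∧ ∀ g ∈ C, ∀ x, ‖twist F g Ψ x‖ ≤ (Φ₀ x).re := by
  induction hΨ using Submodule.span_induction with
  | mem Ψ h => exact exists_piSchwartzBruhat_dominating_twists_of_isFactorizable F h hC
  | zero =>
    refine ⟨0, Submodule.zero_mem _, fun x => by simp, fun g _ x => ?_⟩
    simp [twist_apply]
  | add Ψ Ψ' _ _ ih ih' =>
    obtain ⟨Φ₀, hΦ₀, hr, hd⟩ := ih
    obtain ⟨Φ₀', hΦ₀', hr', hd'⟩ := ih'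
    refine ⟨Φ₀ + Φ₀', Submodule.add_mem _ hΦ₀ hΦ₀', fun x => ?_, fun g hg x => ?_⟩
    · obtain ⟨h1, h2⟩ := hr x
      obtain ⟨h1', h2'⟩ := hr' x
      exact ⟨by simp [h1, h1'], by simpa using add_nonneg h2 h2'⟩
    · rw [twist_apply, Pi.add_apply, Pi.add_apply, Complex.add_re]
      refine (norm_add_le _ _).trans (add_le_add ?_ ?_)
      · simpa only [twist_apply] using hd g hg x
      · simpa only [twist_apply] using hd' g hg x
  | smul a Ψ _ ih =>
    obtain ⟨Φ₀, hΦ₀, hr, hd⟩ := ih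
    refine ⟨(‖a‖ : ℂ) • Φ₀, Submodule.smul_mem _ _ hΦ₀, fun x => ?_, fun g hg x => ?_⟩
    · obtain ⟨h1, h2⟩ := hr x
      refine ⟨by simp [Complex.mul_im, h1], ?_⟩
      simp only [Pi.smul_apply, smul_eq_mul, Complex.mul_re, Complex.ofReal_re, Complex.ofReal_im, zero_mul,
        sub_zero]
      exact mul_nonneg (norm_nonneg _) h2
    · obtain ⟨h1, -⟩ := hr x
      rw [twist_apply, Pi.smul_apply, smul_eq_mul, norm_mul, Pi.smul_apply, smul_eq_mul]
      have hre : ((‖a‖ : ℂ) * Φ₀ x).re = ‖a‖ * (Φ₀ x).re := by simp [Complex.mul_re, h1]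
      rw [hre]
      exact mul_le_mul_of_nonneg_left (by simpa only [twist_apply] using hd g hg x) (norm_nonneg _)

/-- **Real-valued reading**: the same majorant as a function `Φ₀ʳ : 𝔸_Fⁿ → ℝ` with `Φ₀ = Φ₀ʳ` pointwise (for consumers
integrating against positive measures). [cite: Weil1964, Chap. III n° 41, Lemme 5 p. 194] -/
theorem exists_piSchwartzBruhat_dominating_twists' {Ψ : (Fin n → AdeleRing (𝓞 F) F) → ℂ}
    (hΨ : Ψ ∈ piSchwartzBruhat F (Fin n)) {C : Set (GL (Fin n) (AdeleRing (𝓞 F) F))} (hC : IsCompact C) :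
    ∃ Φ₀ : (Fin n → AdeleRing (𝓞 F) F) → ℂ, Φ₀ ∈ piSchwartzBruhat F (Fin n) ∧
      ∃ r : (Fin n → AdeleRing (𝓞 F) F) → ℝ, (∀ x, Φ₀ x = r x) ∧ (∀ x, 0 ≤ r x) ∧
        ∀ g ∈ C, ∀ x, ‖twist F g Ψ x‖ ≤ r x := by
  obtain ⟨Φ₀, hΦ₀, hr, hd⟩ := exists_piSchwartzBruhat_dominating_twists F hΨ hC
  refine ⟨Φ₀, hΦ₀, fun x => (Φ₀ x).re, fun x => ?_, fun x => (hr x).2, hd⟩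
  exact Complex.ext (by simp) (by simp [(hr x).1])

end Main

end Literature.NumberTheory.Weil1964
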